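import Literature.NumberTheory.NumberFields.CyclicQuinticField241Primes
import Literature.NumberTheory.NumberFields.TableAlgebra
import Mathlib.Algebra.Field.Equiv
import Mathlib.Algebra.Field.ZMod
import HarnessLib

/-!
# Residue certificates for quintic orders: no-root certificates and a field criterion

Topic `NumberTheory/NumberFields`; two generic kernel-checkable certificates used by the class-group
computations of the quintic fields of conductor `2651` (`CyclicQuinticField2651K*ClassGroup.lean`),
complementing `QuinticRing.irreducible_poly_of_powCert` (`CyclicQuinticField241Primes.lean`):

* `QuinticRing.not_isRoot_of_noRootCert` — **a quintic over a finite field `F` has no root in `F` if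
  `t^{|F|} - t` is a unit modulo it** (certificate: an inverse `s`, checked by one modular powering);
* `TAlg.isField_of_generator` — **a table algebra `A = TAlg S (ℤ/p)` is a field** as soon as an element
  `γ` whose powers `1, γ, …, γ⁴` span `A` (a coordinate certificate) satisfies a monic quintic which is
  irreducible over `ℤ/p` (then `A ≅ 𝔽_p[t]/(χ)`).

Everything is proved.

## References

* M. O. Rabin, *Probabilistic algorithms in finite fields*, SIAM J. Comput. 9 (1980), §1. [folklore]
* H. Cohen, *A Course in Computational Algebraic Number Theory*, GTM 138 (1993), §3.4, §4.8. [folklore]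
-/

open Polynomial

namespace Literature.NumberTheory.NumberFields

/-! ### No-root certificates -/

namespace QuinticRing

/-- **No root from a unit certificate.** If `(t^{q} - t) · s = 1` in `F[t]/(g)` (`q = |F|`,
`g = poly p₀ … p₄`), then `g` has no root in `F`: at a root `r` the evaluation `F[t]/(g) → F` would send
the unit `t^q - t` to `r^q - r = 0`. [folklore] -/
theorem not_isRoot_of_noRootCert {F : Type*} [Field F] [Fintype F] (p0 p1 p2 p3 p4 : F)
    {bs : List Bool} (hbs : ofBits bs = Fintype.card F) (s : QuinticRing F p0 p1 p2 p3 p4)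
    (h : (powL bs (gen F p0 p1 p2 p3 p4) - gen F p0 p1 p2 p3 p4) * s = 1) (r : F) :
    ¬ (poly p0 p1 p2 p3 p4).IsRoot r := by
  intro hr
  have hev : (poly p0 p1 p2 p3 p4).eval₂ (RingHom.id F) r = 0 := by
    rw [eval₂_id]; exact hr
  let φ : QuinticRing F p0 p1 p2 p3 p4 →+* F := (AdjoinRoot.lift (RingHom.id F) r hev).comp toAdjHom
  have hφ : φ (gen F p0 p1 p2 p3 p4) = r := by
    show AdjoinRoot.lift (RingHom.id F) r hev (toAdj p0 p1 p2 p3 p4 (gen F p0 p1 p2 p3 p4)) = r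
    rw [toAdj_gen, AdjoinRoot.lift_root]
  have key := congrArg φ h
  rw [map_mul, map_sub, powL_eq_pow, map_pow, hφ, hbs, FiniteField.pow_card, sub_self, zero_mul,
    map_one] at key
  exact zero_ne_one key

end QuinticRing

/-! ### A field criterion for table algebras over `ℤ/p` -/

namespace TAlg

variable {S : TableSpec 5} [Fact S.IsRing] {p : ℕ} [Fact p.Prime]

/-- **Field criterion.** Let `γ ∈ A = TAlg S (ℤ/p)` satisfy the monic quintic
`γ⁵ = a₄γ⁴ + a₃γ³ + a₂γ² + a₁γ + a₀` with `QuinticRing.poly a₀ … a₄` irreducible over `ℤ/p`, and suppose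
`1, γ, …, γ⁴` span `A` (coordinate certificate `B`) and `0 ≠ 1` in `A`. Then `A ≅ 𝔽_p[t]/(poly)` is a
field. [folklore] -/
theorem isField_of_generator (γ : TAlg S (ZMod p)) (a0 a1 a2 a3 a4 : ZMod p)
    (hrel : γ ^ 5 = const a4 * γ ^ 4 + const a3 * γ ^ 3 + const a2 * γ ^ 2 + const a1 * γ + const a0)
    (hirr : Irreducible (QuinticRing.poly a0 a1 a2 a3 a4)) (B : Fin 5 → Fin 5 → ZMod p)
    (hB : ∀ b, (basis b : TAlg S (ZMod p)) = ∑ k : Fin 5, const (B b k) * γ ^ (k : ℕ))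
    (h01 : (0 : TAlg S (ZMod p)) ≠ 1) : IsField (TAlg S (ZMod p)) := by
  classical
  haveI : Nontrivial (TAlg S (ZMod p)) := ⟨⟨0, 1, h01⟩⟩
  haveI := Fact.mk hirr
  set χ := QuinticRing.poly a0 a1 a2 a3 a4 with hχ
  have hev : χ.eval₂ (const : ZMod p →+* TAlg S (ZMod p)) γ = 0 := by
    rw [hχ, QuinticRing.poly]
    simp only [eval₂_sub, eval₂_mul, eval₂_C, eval₂_X_pow, eval₂_X]
    rw [hrel]; ring
  let φ : AdjoinRoot χ →+* TAlg S (ZMod p) := AdjoinRoot.lift const γ hev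
  have hφc : ∀ c, φ (AdjoinRoot.of χ c) = const c := fun c => AdjoinRoot.lift_of hev
  have hφr : φ (AdjoinRoot.root χ) = γ := AdjoinRoot.lift_root hev
  have hconst : ∀ c, const c ∈ φ.range := fun c => RingHom.mem_range.mpr ⟨_, hφc c⟩
  have hγ : γ ∈ φ.range := RingHom.mem_range.mpr ⟨_, hφr⟩
  have hsurj : Function.Surjective φ := fun u => by
    have hb : ∀ b, (basis b : TAlg S (ZMod p)) ∈ φ.range := fun b => by
      rw [hB b]
      exact Subring.sum_mem _ fun k _ => Subring.mul_mem _ (hconst _) (Subring.pow_mem _ hγ _)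
    have hu : u ∈ φ.range := by
      rw [eq_sum_basis u]
      exact Subring.sum_mem _ fun b _ => Subring.mul_mem _ (hconst _) (hb b)
    exact RingHom.mem_range.mp hu
  have hinj : Function.Injective φ := φ.injective
  exact MulEquiv.isField (Field.toIsField (AdjoinRoot χ))
    (RingEquiv.ofBijective φ ⟨hinj, hsurj⟩).symm.toMulEquiv

end TAlg

end Literature.NumberTheory.NumberFields
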